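import Summits.CriticalPhenomena.PercolationContinuityZ3.Theorems.SahiMasterFamilyStructCanonical

/-!
# Structure theory of the zero-flag class, IV: pair descent, removable members, and the safe region via frames

Unit `prim-master-conj` (crux anchor stmt-CriticalPhenomena-4575); STRUCTURE-THEORY.md §3.5–§3.7 (gen 6).  With the canonical frames
`cframe U W w` of `SahiMasterFamilyStructCanonical`:
* `cframe_eq_of_robust` — a ROBUST sub-family (all intermediate families structured) has the restricted frames;
* `cframe_eq_self_of_pair_robust` (PD, 3.5) — if every sub-family containing `{v, r}` is structured then `v` is PURE (frame = member);
* the joint induction `structRemoval` proving, for every structured family,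
  (C, 3.6) a member with NON-EMPTY ANNIHILATOR is REMOVABLE — `structured_erase_of_not_subset` — in the precise chain form
  `goodChain_cons_of_erase` (the last member of a good chain stays last over any good chain of the rest minus `v`), and
  (T1, 3.7) the SAFE REGION IS FRAME-MEASURABLE — `mem_safe_iff_cfail`: `φ` is safe iff it fails at least two canonical frames and every
  sub-family containing the frame-failed members is structured.
Pure combinatorics; axioms standard. [this work]
-/

noncomputable section

open scoped Classical

namespace Summit.CriticalPhenomena.PercolationContinuityZ3.Theorems

open Finset Function
open Literature.Probability.LatticeModels.Kahn2022 (Affects)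

variable {ι : Type*} [Fintype ι] {κ : Type*} (U : κ → Set (Set ι))

/-! ### Frame failures and robust sub-families -/

/-- The members of a family whose CANONICAL FRAME fails at `φ` (`Q_φ(W)` of STRUCTURE-THEORY). [this work] -/
def cfail (W : Finset κ) (φ : Set ι) : Finset κ := W.filter fun w => φ ∉ cframe U W w

/-- Membership in `cfail`. [this work] -/
@[simp] theorem mem_cfail {W : Finset κ} {φ : Set ι} {w : κ} : w ∈ cfail U W φ ↔ w ∈ W ∧ φ ∉ cframe U W w := by
  simp [cfail]

/-- Frame failures are member failures. [this work] -/
theorem cfail_subset_failSet (hU : ∀ k, IsUpperSet (U k)) (W : Finset κ) (φ : Set ι) : cfail U W φ ⊆ failSet U W φ := by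
  intro w hw
  rw [mem_cfail] at hw
  exact (mem_failSet U).2 ⟨hw.1, fun h => hw.2 (subset_cframe U hU W w h)⟩

/-- Along a good chain the frame failures are the canonical frame failures. [this work] -/
theorem frameFail_eq_cfail (hU : ∀ k, IsUpperSet (U k)) (hne : ∀ k, (U k).Nonempty) {l : List κ} (hl : GoodChain U l)
    (φ : Set ι) : frameFail U l φ = cfail U l.toFinset φ := by
  ext w
  rw [mem_frameFail, mem_cfail, List.mem_toFinset]
  constructor
  · rintro ⟨hw, h⟩; exact ⟨hw, by rwa [← frameIn_eq_cframe U hU hne hl hw]⟩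
  · rintro ⟨hw, h⟩; exact ⟨hw, by rwa [frameIn_eq_cframe U hU hne hl hw]⟩

/-- **A robust sub-family has the restricted frames**: if every family between `R` and the structured `W` is structured, then on `R`
the canonical frames of `R` are those of `W`. [this work] -/
theorem cframe_eq_of_robust (hU : ∀ k, IsUpperSet (U k)) (hne : ∀ k, (U k).Nonempty) :
    ∀ (n : ℕ) {W R : Finset κ}, (W \ R).card ≤ n → Structured U W → R ⊆ W →
      (∀ R', R ⊆ R' → R' ⊆ W → Structured U R') → ∀ w ∈ R, cframe U R w = cframe U W w
  | 0, W, R, hn, _, hRW, _, w, _ => by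
    have : R = W := Finset.Subset.antisymm hRW (by
      intro x hx; by_contra hxR
      have : x ∈ W \ R := mem_sdiff.2 ⟨hx, hxR⟩
      rw [Nat.le_zero, card_eq_zero] at hn
      rw [hn] at this; exact absurd this (notMem_empty x))
    rw [this]
  | n + 1, W, R, hn, hW, hRW, hrob, w, hw => by
    by_cases heq : R = W
    · rw [heq]
    · obtain ⟨x, hxW, hxR⟩ := exists_of_ssubset (lt_of_le_of_ne hRW heq)
      have hWx : Structured U (W.erase x) := hrob _ (fun y hy => mem_erase.2 ⟨fun h => hxR (h ▸ hy), hRW hy⟩) (erase_subset x W)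
      have e1 : cframe U (W.erase x) w = cframe U W w := cframe_erase U hU hne hW hWx (mem_erase.2 ⟨fun h => hxR (h ▸ hw), hRW hw⟩)
      rw [← e1]
      refine cframe_eq_of_robust hU hne n ?_ hWx (fun y hy => mem_erase.2 ⟨fun h => hxR (h ▸ hy), hRW hy⟩)
        (fun R' h1 h2 => hrob R' h1 (h2.trans (erase_subset x W))) w hw
      have : (W.erase x \ R) = (W \ R).erase x := by
        ext y; simp only [mem_sdiff, mem_erase]; tauto
      rw [this, card_erase_of_mem (mem_sdiff.2 ⟨hxW, hxR⟩)]
      omega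

/-! ### Pair descent -/

/-- In a structured pair the canonical frames are the members. [this work] -/
theorem cframe_pair (hU : ∀ k, IsUpperSet (U k)) (hne : ∀ k, (U k).Nonempty) {v r : κ} (hvr : v ≠ r)
    (h : Structured U ({v, r} : Finset κ)) : cframe U ({v, r} : Finset κ) v = U v := by
  obtain ⟨l, hlW, hl, hlen, hgl⟩ := Structured.exists_chain U h
  rw [card_pair hvr] at hlen
  -- `l` has two elements, `{v, r}` in some order
  obtain ⟨a, b, rfl⟩ : ∃ a b, l = [a, b] := by
    match l, hlen with
    | [a, b], _ => exact ⟨a, b, rfl⟩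
  have hab : a ≠ b := by intro h; subst h; simp at hl
  have hdisj : Disjoint (esupp (U a)) (esupp (U b)) := (goodChain_pair_iff U hU hab).1 hgl
  have hva : v = a ∨ v = b := by
    have : v ∈ ([a, b] : List κ).toFinset := by rw [hlW]; simp
    simpa using this
  rw [← hlW, ← frameIn_eq_cframe U hU hne hgl (by rcases hva with rfl | rfl <;> simp)]
  rcases hva with rfl | rfl
  · rw [frameIn_cons_self, frameSupp_singleton, hull_eq_self_of_disjoint (hU v)]
    simpa [Set.disjoint_left, Finset.disjoint_left] using hdisj.symm
  · rw [frameIn_cons_of_ne U (Ne.symm hab)]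
    simp [frameIn, frameSupp]

/-- **Pair descent** (STRUCTURE-THEORY 3.5): if every sub-family of the structured `W` containing `{v, r}` (`v ≠ r`) is structured, then
the canonical frame of `v` in `W` is `U v` itself (empty annihilator). [this work] -/
theorem cframe_eq_self_of_pair_robust (hU : ∀ k, IsUpperSet (U k)) (hne : ∀ k, (U k).Nonempty) {W : Finset κ}
    (hW : Structured U W) {v r : κ} (hvr : v ≠ r) (hv : v ∈ W) (hr : r ∈ W)
    (hrob : ∀ R', ({v, r} : Finset κ) ⊆ R' → R' ⊆ W → Structured U R') : cframe U W v = U v := by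
  have hsub : ({v, r} : Finset κ) ⊆ W := by
    intro x hx; rcases mem_insert.1 hx with rfl | hx; · exact hv
    · rw [mem_singleton] at hx; rw [hx]; exact hr
  rw [← cframe_eq_of_robust U hU hne _ le_rfl hW hsub hrob v (mem_insert_self v {r})]
  exact cframe_pair U hU hne hvr (hrob _ subset_rfl hsub)

/-! ### The joint induction: removable members (C) and the safe region via frames (T1) -/

/-- C in chain form: in a good chain `u :: l`, a member `v` of `l` with non-empty annihilator (w.r.t. the family of `l`) can be removed,
and `u` stays last over ANY good chain of the rest. [this work] -/
def CChain (W : Finset κ) : Prop :=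
  ∀ (u : κ) (l : List κ), GoodChain U (u :: l) → (u :: l).toFinset = W → ∀ v ∈ l, ¬ (cframe U l.toFinset v ⊆ U v) →
    Structured U (l.toFinset.erase v) ∧
      ∀ l₂ : List κ, l₂.toFinset = l.toFinset.erase v → GoodChain U l₂ → GoodChain U (u :: l₂)

/-- C: members with non-empty annihilator are removable. [this work] -/
def CRem (W : Finset κ) : Prop := ∀ v ∈ W, ¬ (cframe U W v ⊆ U v) → Structured U (W.erase v)

/-- T1: the safe region via canonical frame failures. [this work] -/
def TOne (W : Finset κ) : Prop :=
  ∀ φ : Set ι, φ ∈ Safe U W ↔ 2 ≤ (cfail U W φ).card ∧ ∀ R, cfail U W φ ⊆ R → R ⊆ W → Structured U R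

/-- From the chain form of C to removability. [this work] -/
theorem cRem_of_cChain (hU : ∀ k, IsUpperSet (U k)) (hne : ∀ k, (U k).Nonempty) {W : Finset κ} (hW : Structured U W)
    (hC : CChain U W) : CRem U W := by
  intro v hv hN
  obtain ⟨l, hlW, hl⟩ := hW
  subst hlW
  match l, hl, hv with
  | [], _, hv => simp at hv
  | u :: l, hl, hv =>
    by_cases huv : v = u
    · subst huv
      have : (v :: l).toFinset.erase v = l.toFinset := by
        rw [List.toFinset_cons, erase_insert (fun h => ((goodChain_cons U).1 hl).2.1 (List.mem_toFinset.1 h))]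
      rw [this]; exact ⟨l, rfl, GoodChain.tail U hl⟩
    · have hvl : v ∈ l := by simpa [huv] using hv
      have hul : u ∉ l := ((goodChain_cons U).1 hl).2.1
      -- the annihilator w.r.t. `l` is the one w.r.t. `u :: l`
      have hlt : Structured U l.toFinset := ⟨l, rfl, GoodChain.tail U hl⟩
      have e : (u :: l).toFinset.erase u = l.toFinset := by rw [List.toFinset_cons, erase_insert (fun h => hul (List.mem_toFinset.1 h))]
      have hN' : ¬ (cframe U l.toFinset v ⊆ U v) := by
        rw [← e, cframe_erase U hU hne ⟨u :: l, rfl, hl⟩ (e.symm ▸ hlt) (by rw [e]; exact List.mem_toFinset.2 hvl)]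
        exact hN
      obtain ⟨hst, hch⟩ := hC u l hl rfl v hvl hN'
      obtain ⟨l₂, hl₂W, hl₂⟩ := hst
      refine ⟨u :: l₂, ?_, hch l₂ hl₂W hl₂⟩
      rw [List.toFinset_cons, hl₂W, List.toFinset_cons, erase_insert_of_ne (Ne.symm huv)]

/-- The step for C (size `n + 1` from everything at size `≤ n`). [this work] -/
theorem cChain_step (hU : ∀ k, IsUpperSet (U k)) (hne : ∀ k, (U k).Nonempty) (n : ℕ)
    (IH : ∀ W' : Finset κ, Structured U W' → W'.card ≤ n → CRem U W' ∧ TOne U W') {W : Finset κ} (hWn : W.card ≤ n + 1) :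
    CChain U W := by
  intro u l hul hW v hvl hNv
  have hl : GoodChain U l := GoodChain.tail U hul
  have hu : u ∉ l := ((goodChain_cons U).1 hul).2.1
  have hNu : hull (frameSupp U l) (U u) \ U u ⊆ Safe U l.toFinset := ((goodChain_cons U).1 hul).2.2
  set W' : Finset κ := l.toFinset with hW'def
  have hW' : Structured U W' := ⟨l, rfl, hl⟩
  have hW'n : W'.card ≤ n := by
    have : W.card = W'.card + 1 := by
      rw [← hW, List.toFinset_cons, card_insert_of_notMem (fun h => hu (List.mem_toFinset.1 h))]
    omega
  obtain ⟨hCR', hT1'⟩ := IH W' hW' hW'n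
  -- `v` is removable from `W'`
  have hWv : Structured U (W'.erase v) := hCR' v (List.mem_toFinset.2 hvl) hNv
  refine ⟨hWv, fun l₂ hl₂W hl₂ => ?_⟩
  rw [goodChain_cons]
  refine ⟨hl₂, fun h => (mem_erase.1 (hl₂W ▸ List.mem_toFinset.2 h : u ∈ W'.erase v)).2 |> fun h' => hu (List.mem_toFinset.1 h'),
    ?_⟩
  -- the new annihilator of `u` is smaller than the old one
  have hSsub : frameSupp U l₂ ⊆ frameSupp U l := by
    rw [frameSupp_eq_biUnion_cframe U hU hne hl₂, frameSupp_eq_biUnion_cframe U hU hne hl, hl₂W]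
    intro i hi
    rw [Set.mem_iUnion₂] at hi ⊢
    obtain ⟨w, hw, hiw⟩ := hi
    exact ⟨w, mem_of_mem_erase hw, by rwa [← cframe_erase U hU hne hW' hWv hw]⟩
  intro φ hφ
  have hφN : φ ∈ hull (frameSupp U l) (U u) \ U u := ⟨hull_mono_left (hU u) hSsub hφ.1, hφ.2⟩
  have hφs : φ ∈ Safe U W' := hNu hφN
  obtain ⟨h2, hsup⟩ := (hT1' φ).1 hφs
  rw [hl₂W, mem_safe]
  constructor
  · -- size: at least two failures remain after removing `v`
    by_cases hvc : v ∈ cfail U W' φ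
    · -- if exactly `{v, r}` failed, pair descent would make `v` pure
      by_contra hlt
      push Not at hlt
      have hsub1 : (cfail U W' φ).erase v ⊆ failSet U (W'.erase v) φ := by
        intro w hw
        rw [mem_erase] at hw
        have hw' := cfail_subset_failSet U hU W' φ hw.2
        rw [mem_failSet] at hw' ⊢
        exact ⟨mem_erase.2 ⟨hw.1, hw'.1⟩, hw'.2⟩
      have hc2 : (cfail U W' φ).card = 2 := by
        have := card_le_card hsub1
        rw [card_erase_of_mem hvc] at this
        omega
      obtain ⟨a, b, hab, hcf⟩ := card_eq_two.1 hc2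
      have hva : v = a ∨ v = b := by simpa [hcf] using hvc
      -- the other element
      obtain ⟨r, hvr, hpair⟩ : ∃ r, v ≠ r ∧ cfail U W' φ = {v, r} := by
        rcases hva with rfl | rfl
        · exact ⟨b, hab, hcf⟩
        · exact ⟨a, Ne.symm hab, by rw [hcf, pair_comm]⟩
      have hrW : r ∈ W' := (mem_cfail U).1 (by rw [hpair]; simp) |>.1
      have hpure := cframe_eq_self_of_pair_robust U hU hne hW' hvr (List.mem_toFinset.2 hvl) hrW
        (fun R' h1 h2 => hsup R' (by rw [hpair]; exact h1) h2)
      exact hNv (by rw [hpure])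
    · have hsub1 : cfail U W' φ ⊆ failSet U (W'.erase v) φ := by
        intro w hw
        have hw' := cfail_subset_failSet U hU W' φ hw
        rw [mem_failSet] at hw' ⊢
        exact ⟨mem_erase.2 ⟨fun h => hvc (h ▸ hw), hw'.1⟩, hw'.2⟩
      exact h2.trans (card_le_card hsub1)
  · -- supersets: add `v` back, use robustness and remove `v` again by C at smaller size
    intro R hR1 hR2
    have hvR : v ∉ R := fun h => (mem_erase.1 (hR2 h)).1 rfl
    set R' : Finset κ := insert v R with hR'def
    have hR'W : R' ⊆ W' := insert_subset (List.mem_toFinset.2 hvl) (hR2.trans (erase_subset v W'))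
    have hcR' : cfail U W' φ ⊆ R' := by
      intro w hw
      by_cases hwv : w = v
      · rw [hwv]; exact mem_insert_self v R
      · refine mem_insert_of_mem (hR1 ?_)
        have hw' := cfail_subset_failSet U hU W' φ hw
        rw [mem_failSet] at hw' ⊢
        exact ⟨mem_erase.2 ⟨hwv, hw'.1⟩, hw'.2⟩
    have hrob : ∀ R'', R' ⊆ R'' → R'' ⊆ W' → Structured U R'' := fun R'' h1 h2 => hsup R'' (hcR'.trans h1) h2
    have hR's : Structured U R' := hrob R' subset_rfl hR'W
    have hR'card : R'.card ≤ n := (card_le_card hR'W).trans hW'n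
    -- frames of `R'` are restricted, so `v` still has a non-empty annihilator there
    have hNv' : ¬ (cframe U R' v ⊆ U v) := by
      rw [cframe_eq_of_robust U hU hne _ le_rfl hW' hR'W hrob v (mem_insert_self v R)]
      exact hNv
    have := (IH R' hR's hR'card).1 v (mem_insert_self v R) hNv'
    rwa [hR'def, erase_insert hvR] at this

/-- The step for T1 (size `≤ n` from C at sizes `≤ n`). [this work] -/
theorem tOne_step (hU : ∀ k, IsUpperSet (U k)) (hne : ∀ k, (U k).Nonempty) (n : ℕ)
    (IHC : ∀ W' : Finset κ, Structured U W' → W'.card ≤ n → CRem U W') {W : Finset κ} (hW : Structured U W) (hWn : W.card ≤ n) :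
    TOne U W := by
  intro φ
  constructor
  · intro hφ
    obtain ⟨l, hlW, hl⟩ := id hW
    constructor
    · -- T′
      have := two_le_card_frameFail U l.length le_rfl hl hU φ (Or.inl (hlW.symm ▸ hφ))
      rwa [frameFail_eq_cfail U hU hne hl, hlW] at this
    · intro R hR1 hR2
      -- remove the annihilated failed members one at a time from `R ∪ failSet`
      have key : ∀ (P : Finset κ), ∀ F : Finset κ, Structured U F → F ⊆ W → R ⊆ F → P ⊆ F \ R →
          (∀ x ∈ F, cframe U F x = cframe U W x) → (∀ x ∈ P, φ ∈ cframe U W x ∧ φ ∉ U x) → Structured U (F \ P) := by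
        intro P
        induction P using Finset.induction_on with
        | empty => intro F hF _ _ _ _ _; simpa using hF
        | insert x P hxP ih =>
          intro F hF hFW hRF hPF hfr hann
          have hxF : x ∈ F := (mem_sdiff.1 (hPF (mem_insert_self x P))).1
          -- `x` has a non-empty annihilator in `F`
          have hNx : ¬ (cframe U F x ⊆ U x) := by
            rw [hfr x hxF]
            exact fun h => (hann x (mem_insert_self x P)).2 (h (hann x (mem_insert_self x P)).1)
          have hFx : Structured U (F.erase x) := IHC F hF ((card_le_card hFW).trans hWn) x hxF hNx
          have e : F \ insert x P = F.erase x \ P := by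
            ext y; simp only [mem_sdiff, mem_insert, mem_erase]; tauto
          rw [e]
          refine ih (F.erase x) hFx ((erase_subset x F).trans hFW) (fun y hy => mem_erase.2 ⟨?_, hRF hy⟩) ?_ ?_ ?_
          · intro h; subst h; exact (mem_sdiff.1 (hPF (mem_insert_self y P))).2 hy
          · intro y hy
            have := hPF (mem_insert_of_mem hy)
            rw [mem_sdiff] at this ⊢
            exact ⟨mem_erase.2 ⟨fun h => hxP (h ▸ hy), this.1⟩, this.2⟩
          · intro y hy
            rw [cframe_erase U hU hne hF hFx hy]
            exact hfr y (mem_of_mem_erase hy)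
          · exact fun y hy => hann y (mem_insert_of_mem hy)
      set F : Finset κ := R ∪ failSet U W φ with hFdef
      have hFW : F ⊆ W := union_subset hR2 (failSet_subset U W φ)
      have hFs : Structured U F := ((mem_safe U).1 hφ).2 F subset_union_right hFW
      -- `F` is robust (superset of the fail set), so its frames are restricted
      have hFrob : ∀ R'', F ⊆ R'' → R'' ⊆ W → Structured U R'' :=
        fun R'' h1 h2 => ((mem_safe U).1 hφ).2 R'' (subset_union_right.trans h1) h2
      have hfr : ∀ x ∈ F, cframe U F x = cframe U W x := cframe_eq_of_robust U hU hne _ le_rfl hW hFW hFrob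
      have hres := key (F \ R) F hFs hFW subset_union_left subset_rfl hfr (by
        intro x hx
        rw [mem_sdiff, hFdef, mem_union] at hx
        obtain ⟨hx1, hx2⟩ := hx
        have hxf : x ∈ failSet U W φ := hx1.resolve_left hx2
        refine ⟨?_, ((mem_failSet U).1 hxf).2⟩
        by_contra hxc
        exact hx2 (hR1 ((mem_cfail U).2 ⟨(mem_failSet U).1 hxf |>.1, hxc⟩)))
      have e : F \ (F \ R) = R := by
        rw [sdiff_sdiff_right_self, inf_eq_right.2 (subset_union_left : R ⊆ F)]
      rwa [e] at hres
  · rintro ⟨h2, hsup⟩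
    rw [mem_safe]
    refine ⟨h2.trans (card_le_card (cfail_subset_failSet U hU W φ)), fun R h1 h2' => hsup R ((cfail_subset_failSet U hU W φ).trans h1) h2'⟩

/-- **The joint induction** (STRUCTURE-THEORY 3.6–3.7): every structured family satisfies C (chain form and removability) and T1.
[this work] -/
theorem structRemoval (hU : ∀ k, IsUpperSet (U k)) (hne : ∀ k, (U k).Nonempty) :
    ∀ (n : ℕ) (W : Finset κ), Structured U W → W.card ≤ n → (CChain U W ∧ CRem U W) ∧ TOne U W
  | 0, W, hW, hn => by
    have hW0 : W = ∅ := card_eq_zero.1 (Nat.le_zero.1 hn)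
    subst hW0
    refine ⟨⟨?_, fun v hv => absurd hv (notMem_empty v)⟩, tOne_step U hU hne 0 (fun W' _ h0 => ?_) hW hn⟩
    · intro u l _ h; exact absurd h (by simp)
    · have : W' = ∅ := card_eq_zero.1 (Nat.le_zero.1 h0)
      subst this; exact fun v hv => absurd hv (notMem_empty v)
  | n + 1, W, hW, hn => by
    have IH : ∀ W' : Finset κ, Structured U W' → W'.card ≤ n → CRem U W' ∧ TOne U W' :=
      fun W' hW' h => ⟨(structRemoval hU hne n W' hW' h).1.2, (structRemoval hU hne n W' hW' h).2⟩
    have hCC : ∀ W' : Finset κ, Structured U W' → W'.card ≤ n + 1 → CChain U W' :=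
      fun W' _ h => cChain_step U hU hne n IH h
    have hCR : ∀ W' : Finset κ, Structured U W' → W'.card ≤ n + 1 → CRem U W' :=
      fun W' hW' h => cRem_of_cChain U hU hne hW' (hCC W' hW' h)
    exact ⟨⟨hCC W hW hn, hCR W hW hn⟩, tOne_step U hU hne (n + 1) hCR hW hn⟩

/-- **C (STRUCTURE-THEORY 3.6): a member with non-empty annihilator is removable.** [this work] -/
theorem structured_erase_of_not_subset (hU : ∀ k, IsUpperSet (U k)) (hne : ∀ k, (U k).Nonempty) {W : Finset κ}
    (hW : Structured U W) {v : κ} (hv : v ∈ W) (hN : ¬ (cframe U W v ⊆ U v)) : Structured U (W.erase v) :=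
  (structRemoval U hU hne W.card W hW le_rfl).1.2 v hv hN

/-- **C, chain form**: the last member of a good chain stays last when a member with non-empty annihilator is removed from the rest.
[this work] -/
theorem goodChain_cons_of_erase (hU : ∀ k, IsUpperSet (U k)) (hne : ∀ k, (U k).Nonempty) {u : κ} {l : List κ}
    (hul : GoodChain U (u :: l)) {v : κ} (hvl : v ∈ l) (hN : ¬ (cframe U l.toFinset v ⊆ U v)) :
    Structured U (l.toFinset.erase v) ∧ ∀ l₂ : List κ, l₂.toFinset = l.toFinset.erase v → GoodChain U l₂ → GoodChain U (u :: l₂) :=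
  (structRemoval U hU hne _ (u :: l).toFinset ⟨u :: l, rfl, hul⟩ le_rfl).1.1 u l hul rfl v hvl hN

/-- **T1 (STRUCTURE-THEORY 3.7): the safe region is frame-measurable.** [this work] -/
theorem mem_safe_iff_cfail (hU : ∀ k, IsUpperSet (U k)) (hne : ∀ k, (U k).Nonempty) {W : Finset κ} (hW : Structured U W)
    (φ : Set ι) : φ ∈ Safe U W ↔ 2 ≤ (cfail U W φ).card ∧ ∀ R, cfail U W φ ⊆ R → R ⊆ W → Structured U R :=
  (structRemoval U hU hne W.card W hW le_rfl).2 φ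

end Summit.CriticalPhenomena.PercolationContinuityZ3.Theorems
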